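import Literature.NumberTheory.GaloisCohomology.BrauerSumTwoTorsionAtOnePlace
import HarnessLib

/-!
# A finite set of finite places and the real places: `Σ_{v ∈ T} inv_v(c) = −Σ_{w ∣ ∞} inv_w(c)` and
# `2 • Σ_{v ∈ T} inv_v(c) = 0` for a global class of `H²(Γ_K, μₙ)` whose invariants vanish at the finite places outside `T`

Topic `NumberTheory/GaloisCohomology`; namespace `Literature.NumberTheory.GaloisCohomology`. THEOREMS ONLY (no definition, no
named fact, no instance, no `sorry`). Number fields in `Type` (as in `PoitouTateNumberField.lean`). Companion of
`BrauerSumTwoTorsionAtOnePlace.lean` (the case `T = {v₀}`).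

For a number field `K`, `n ≥ 1`, a finite set `T` of finite places and `c ∈ H²(Γ_K, μₙ) = Br(K)[n]` with `inv_v(loc_v c) = 0` at
every FINITE `v ∉ T`, the reciprocity law `∑_v inv_v(loc_v c) = 0` for THE invariant maps (`LocalInvariants.canonical`, tree theorem
`sumInvLocalizationEqZero_canonical_of_numberField`) reads

* `sum_localInvariantMap_eq_neg_sum_archimedean` — **`Σ_{v ∈ T} inv_v(loc_v c) = −Σ_{w ∣ ∞} inv_w(loc_w c)`** (exact identity);
* `two_nsmul_sum_localInvariantMap_eq_zero_of_forall_not_mem` — **`2 • Σ_{v ∈ T} inv_v(loc_v c) = 0`** (the archimedean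
  invariants are `2`-torsion, `two_nsmul_archimedeanInvariantMap`); `…_of_localization_eq_zero` (hypothesis: the localisations
  vanish as classes), `…_levels` (hypothesis at a `v`-dependent higher level `μₙ ↪ μ_N`, `localization_muInclHom_eq_zero_iff`);
* `sum_localInvariantMap_eq_zero_of_archimedean`, `sum_localInvariantMap_eq_zero_of_localization_inl_eq_zero` — the EXACT
  form `Σ_{v ∈ T} inv_v(loc_v c) = 0` when moreover the archimedean invariants (resp. the archimedean localisations) of `c` vanish.

Why the finite-SET form (the one-place file sufficed for `p`-PRIMITIVE Selmer structures, where every local term off `p` dies):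
for an `S₀`-IMPRIMITIVE Selmer structure (relaxed at `S₀`) the local terms of the reciprocity law at `S₀` survive and must be
COLLECTED — consumer: the reciprocity stub `stub_reciprocity` (EH) of crux RSL_g `ResidualSignedLambdaLowerCMAtTwo` of
`Summits/BirchSwinnertonDyer` (Tate–Poitou along the cyclotomic `ℤ₂`-tower for an `S₀`-relaxed Selmer group, `T = {2} ∪ S₀`).
Proofs adapted from the kernel-checked crux sketches `Cruxes/ResidualThetaCountLowerPureAtTwo/Sketch_sidea_k1_g10.lean` §B and
`Sketch_sidea_k2_g10.lean` §1 (stub-ideation seats k1/k2 gen 10).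

## References
* J. W. S. Cassels, A. Fröhlich (eds.), *Algebraic Number Theory* (1967), Ch. VII (Tate) §9.6, §11. [CasselsFrohlichANT1967]
* J. S. Milne, *Arithmetic Duality Theorems*, 2nd ed. (2006), Ch. I Thm. 4.10 (b), Ex. 1.6 (c). [MilneADT2006]
* J.-P. Serre, *Local Fields* (1979), XIII §3 Cor. 3. [SerreLocalFields1979]
-/

noncomputable section

open CategoryTheory Function Field NumberField IsDedekindDomain
open scoped NumberField

namespace Literature.NumberTheory.GaloisCohomology

open _root_.ContinuousCohomology
open Literature.NumberTheory.GaloisRepresentations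
open Literature.NumberTheory.GaloisRepresentations.DiscreteGaloisModule

variable (K : Type) [Field K] [NumberField K] (n : ℕ) [NeZero n]

/-- **`Σ_{v ∈ T} inv_v(loc_v c) = −Σ_{w ∣ ∞} inv_w(loc_w c)`** for `c ∈ H²(Γ_K, μₙ)` whose invariants vanish at the finite places
outside the finite set `T`: Tate's reciprocity law `∑_v inv_v = 0` for THE invariant maps, over the finite set `T ∪ {w ∣ ∞}`.
[cite: CasselsFrohlichANT1967, Ch. VII §11] [cite: MilneADT2006, Ch. I, Thm. 4.10(b)] -/
theorem sum_localInvariantMap_eq_neg_sum_archimedean (T : Finset (HeightOneSpectrum (𝓞 K))) (c : galoisCohomology (mu K n) 2)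
    (h : ∀ v : HeightOneSpectrum (𝓞 K), v ∉ T →
      localInvariantMap K n v (galoisCohomology.localization (mu K n) (Sum.inr v) 2 c) = 0) :
    ∑ v ∈ T, localInvariantMap K n v (galoisCohomology.localization (mu K n) (Sum.inr v) 2 c) =
      -∑ w : InfinitePlace K, archimedeanInvariantMap K n w (galoisCohomology.localization (mu K n) (Sum.inl w) 2 c) := by
  classical
  -- the finite set `S = {w ∣ ∞} ∪ T`
  let S : Finset (Place K) := (Finset.univ.image Sum.inl) ∪ T.image Sum.inr
  have hS : ∀ v ∉ S, LocalInvariants.canonical K n v (galoisCohomology.localization (mu K n) v 2 c) = 0 := by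
    rintro (w | v) hv
    · exact absurd (Finset.mem_union_left _ (Finset.mem_image_of_mem _ (Finset.mem_univ w))) hv
    · have hne : v ∉ T := fun e ↦ hv (Finset.mem_union_right _ (Finset.mem_image_of_mem _ e))
      rw [LocalInvariants.canonical_inr]
      exact h v hne
  have hsum := sumInvLocalizationEqZero_canonical_of_numberField K n c S hS
  have hdisj : Disjoint (Finset.univ.image Sum.inl : Finset (Place K)) (T.image Sum.inr) := by
    rw [Finset.disjoint_left]
    intro x hx hx'
    simp only [Finset.mem_image, Finset.mem_univ, true_and] at hx hx'
    obtain ⟨w, rfl⟩ := hx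
    obtain ⟨v, _, hv⟩ := hx'
    exact Sum.inr_ne_inl hv
  rw [Finset.sum_union hdisj, Finset.sum_image (fun _ _ _ _ e ↦ Sum.inl_injective e),
    Finset.sum_image (fun _ _ _ _ e ↦ Sum.inr_injective e)] at hsum
  simp only [LocalInvariants.canonical_inr, LocalInvariants.canonical_inl] at hsum
  exact eq_neg_of_add_eq_zero_right hsum

/-- **`2 • Σ_{v ∈ T} inv_v(loc_v c) = 0`** when the invariants of `c ∈ H²(Γ_K, μₙ)` vanish at every finite `v ∉ T`: the archimedean
invariants are `2`-torsion (`two_nsmul_archimedeanInvariantMap`). The finite-set generalisation of the tree's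
`two_nsmul_localInvariantMap_eq_zero_of_forall_ne` (`T = {v₀}`).
[cite: CasselsFrohlichANT1967, Ch. VII §11] [cite: MilneADT2006, Ch. I, Thm. 4.10(b) and Ex. 1.6 (c)] -/
theorem two_nsmul_sum_localInvariantMap_eq_zero_of_forall_not_mem (T : Finset (HeightOneSpectrum (𝓞 K)))
    (c : galoisCohomology (mu K n) 2)
    (h : ∀ v : HeightOneSpectrum (𝓞 K), v ∉ T →
      localInvariantMap K n v (galoisCohomology.localization (mu K n) (Sum.inr v) 2 c) = 0) :
    2 • ∑ v ∈ T, localInvariantMap K n v (galoisCohomology.localization (mu K n) (Sum.inr v) 2 c) = 0 := by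
  rw [sum_localInvariantMap_eq_neg_sum_archimedean K n T c h, smul_neg, Finset.smul_sum, neg_eq_zero]
  exact Finset.sum_eq_zero fun w _ ↦ two_nsmul_archimedeanInvariantMap _

/-- **`2 • Σ_{v ∈ T} inv_v(loc_v c) = 0`, classes form**: the localisations of `c` VANISH (as classes) at the finite `v ∉ T`.
[cite: CasselsFrohlichANT1967, Ch. VII §11] [cite: MilneADT2006, Ch. I, Thm. 4.10(b)] -/
theorem two_nsmul_sum_localInvariantMap_eq_zero_of_localization_eq_zero (T : Finset (HeightOneSpectrum (𝓞 K)))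
    (c : galoisCohomology (mu K n) 2)
    (h : ∀ v : HeightOneSpectrum (𝓞 K), v ∉ T → galoisCohomology.localization (mu K n) (Sum.inr v) 2 c = 0) :
    2 • ∑ v ∈ T, localInvariantMap K n v (galoisCohomology.localization (mu K n) (Sum.inr v) 2 c) = 0 :=
  two_nsmul_sum_localInvariantMap_eq_zero_of_forall_not_mem K n T c fun v hv ↦ by rw [h v hv, map_zero]

/-- **`2 • Σ_{v ∈ T} inv_v(loc_v c) = 0`, levels chosen place by place**: at each finite `v ∉ T` the vanishing is known for the image
of `c` at SOME higher level `μₙ ↪ μ_N` (`n ∣ N`; level-insensitivity `localization_muInclHom_eq_zero_iff`) — the shape produced along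
a `ℤ_p`-tower, where the term at `v` is killed at a `v`-dependent coefficient level.
[cite: CasselsFrohlichANT1967, Ch. VII §11] [cite: SerreLocalFields1979, XIII §3 Cor. 3] -/
theorem two_nsmul_sum_localInvariantMap_eq_zero_of_forall_not_mem_levels (T : Finset (HeightOneSpectrum (𝓞 K)))
    (c : galoisCohomology (mu K n) 2)
    (h : ∀ v : HeightOneSpectrum (𝓞 K), v ∉ T → ∃ (N : ℕ) (_ : NeZero N) (hdvd : n ∣ N),
      haveI : CompactSpace (absoluteGaloisGroup K) := absoluteGaloisGroup_compactSpace K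
      galoisCohomology.localization (mu K N) (Sum.inr v) 2 (cohomologyMap (muInclHom K hdvd) 2 c) = 0) :
    2 • ∑ v ∈ T, localInvariantMap K n v (galoisCohomology.localization (mu K n) (Sum.inr v) 2 c) = 0 := by
  refine two_nsmul_sum_localInvariantMap_eq_zero_of_forall_not_mem K n T c fun v hv ↦ ?_
  obtain ⟨N, _, hdvd, hN⟩ := h v hv
  rw [(localization_muInclHom_eq_zero_iff hdvd v c).mp hN, map_zero]

/-- **Exact form**: if the invariants of `c` vanish at the finite `v ∉ T` AND the archimedean invariants of `c` vanish, then
`Σ_{v ∈ T} inv_v(loc_v c) = 0` on the nose. [cite: MilneADT2006, Ch. I, Thm. 4.10(b)] -/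
theorem sum_localInvariantMap_eq_zero_of_archimedean (T : Finset (HeightOneSpectrum (𝓞 K))) (c : galoisCohomology (mu K n) 2)
    (h : ∀ v : HeightOneSpectrum (𝓞 K), v ∉ T →
      localInvariantMap K n v (galoisCohomology.localization (mu K n) (Sum.inr v) 2 c) = 0)
    (hinf : ∀ w : InfinitePlace K, archimedeanInvariantMap K n w (galoisCohomology.localization (mu K n) (Sum.inl w) 2 c) = 0) :
    ∑ v ∈ T, localInvariantMap K n v (galoisCohomology.localization (mu K n) (Sum.inr v) 2 c) = 0 := by
  rw [sum_localInvariantMap_eq_neg_sum_archimedean K n T c h, neg_eq_zero]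
  exact Finset.sum_eq_zero fun w _ ↦ hinf w

/-- **Exact form, classes at infinity**: if the invariants of `c` vanish at the finite `v ∉ T` and the LOCALISATIONS of `c` at the
infinite places vanish as classes (e.g. one factor of a cup product dies at every real place), then `Σ_{v ∈ T} inv_v(loc_v c) = 0`.
[cite: MilneADT2006, Ch. I, Thm. 4.10(b)] -/
theorem sum_localInvariantMap_eq_zero_of_localization_inl_eq_zero (T : Finset (HeightOneSpectrum (𝓞 K)))
    (c : galoisCohomology (mu K n) 2)
    (h : ∀ v : HeightOneSpectrum (𝓞 K), v ∉ T →
      localInvariantMap K n v (galoisCohomology.localization (mu K n) (Sum.inr v) 2 c) = 0)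
    (hinf : ∀ w : InfinitePlace K, galoisCohomology.localization (mu K n) (Sum.inl w) 2 c = 0) :
    ∑ v ∈ T, localInvariantMap K n v (galoisCohomology.localization (mu K n) (Sum.inr v) 2 c) = 0 :=
  sum_localInvariantMap_eq_zero_of_archimedean K n T c h fun w ↦ by rw [hinf w, map_zero]

end Literature.NumberTheory.GaloisCohomology

end
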